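import Summits.ValiantsHypothesis.ValiantsHypothesis.Theorems.DivisionGapPerDivisionHardStubBlockArsenal

/-!
# Crux `DivisionGap.PerDivisionHard` (stmt-ValiantsHypothesis-5065), line `pair-descent-jss-endpoint` —
stub `stub_erasedArsenal`: the erased block face is still hard

`stub_erasedArsenal`: for all `c κ` there are `d n₁` such that for `n ≥ n₁`, every placement
`eR eC : BlockV b k m ≃ Fin n` of the block arsenal `G(b,k) ⊕ M₀` (`k ≥ 1`), every set `I` of hub
rows with `b ≥ (log₂ n + d)^d + |I|`, and every set `D` of cells whose ROW label is a hub row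
`i ∈ I` or an internal vertex `(i, j, t)` with `i ∈ I`, satisfy
`((n+2)(2^{(log₂ n + c)^c} + 3))^κ < L_{ℝ≥0}(Σ_{σ ⊆ G} x^{μ_σ ∖ D})`, the right-hand side being the
complexity of the ERASED face permanent `aeval (x_e ↦ 1 on D, x_e ↦ x_e off D) (facePer G)`.

## Proof

A variant of the phase projection `blockSubst` of `…StubBlockArsenal.lean` that reads ONLY the hub
rows outside `I`.  Fix a reindexing `e₀ : {i // i ∉ I} ≃ Fin b'`.  The substitution
`erasedSubst` sends the variable of a cell whose row label is a hub row `i ∉ I` and whose column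
label carries the core-column index `j` (`phaseIdx`) to `X (e₀ i, e₀ j)` if `j ∉ I` and to `0` if
`j ∈ I`; every other variable (hub rows in `I`, internal rows, padding rows) goes to `1`.  It is a
projection (`isProjection_erasedSubst`), and it does not see the erased cells, so erasing first
changes nothing (`aeval_erasedSubst_aeval_erase`, two algebra maps agreeing on variables).

A permutation `σ` inside the placed face is a perfect matching `g = rowMatching eR eC σ` with
bijective phase map (`phaseMap_bijective_of_adj`), and its monomial goes to
`∏_{i ∉ I} [phaseMap g i ∉ I] X (e₀ i, e₀ (phaseMap g i))`: zero unless `phaseMap g` preserves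
`Iᶜ`, in which case it is the pattern `∏_x X (x, F x)` of the induced bijection `F` of `Fin b'`
(`erasedPhase`, `aeval_erasedSubst_monomial_eq`).  Every permutation `ρ` of `Fin b'` occurs:
extend it by the identity on `I` (`Equiv.Perm.ofSubtype`) and realise the extension as a phase
map (`exists_adj_phaseMap_eq`).  Hence the image has the support of `per_{b'}`
(`support_sum_prod_X_eq_perPoly`), and with `b' = b - |I| ≥ (log₂ n + d)^d` part Aux's
`complexity_gt_of_perSupport_projection` concludes.
-/

noncomputable section

-- `Summit.ValiantsHypothesis.ValiantsHypothesis.…` is the tree's mandated single-conjunct layout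
-- (Sub = Summit), so the duplicated namespace component is intended.
set_option linter.dupNamespace false

namespace Summit.ValiantsHypothesis.ValiantsHypothesis.Theorems.DivisionGapPerDivisionHard

open MvPolynomial Literature.Computability.AlgebraicComplexity
open scoped NNReal

variable {b k m n b' : ℕ}

section Erased

variable (I : Finset (Fin b)) (e₀ : {i // i ∉ I} ≃ Fin b')

/-! ### The erased phase projection -/

/-- Reindexing of a core index `j ∉ I` into `Fin b'` along `e₀` (the junk value `dflt` on `I`).
[folklore] -/
def erasedIdx (j : Fin b) (dflt : Fin b') : Fin b' :=
  if h : j ∈ I then dflt else e₀ ⟨j, h⟩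

/-- The value substituted at a cell of the hub row reindexed `x` whose column label carries the
core-column index `j`: `0` if `j ∈ I` (a zeroed transversal), `X (x, e₀ j)` otherwise. [folklore] -/
def erasedTarget (x : Fin b') (j : Fin b) : MvPolynomial (Fin b' × Fin b') ℝ≥0 :=
  if j ∈ I then 0 else X (x, erasedIdx I e₀ j x)

/-- The erased substitution on labels: the cell (hub row `i ∉ I`, column `ℓ`) ↦
`erasedTarget (e₀ i) (phaseIdx i ℓ)`; hub rows in `I`, internal rows and padding rows ↦ `1`.
[folklore] -/
def erasedLabelSubst (r ℓ : BlockV b k m) : MvPolynomial (Fin b' × Fin b') ℝ≥0 :=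
  match r with
  | Sum.inl i => if hi : i ∈ I then 1 else erasedTarget I e₀ (e₀ ⟨i, hi⟩) (phaseIdx i ℓ)
  | Sum.inr _ => 1

/-- The erased substitution on the cells of the placed matrix. [folklore] -/
def erasedSubst (eR eC : BlockV b k m ≃ Fin n) (e : Fin n × Fin n) :
    MvPolynomial (Fin b' × Fin b') ℝ≥0 :=
  erasedLabelSubst I e₀ (eR.symm e.1) (eC.symm e.2)

/-- The self-map of `Fin b'` induced along `e₀` by a self-map `φ` of `Fin b` (meaningful when `φ`
preserves the complement of `I`). [folklore] -/
def erasedPhase (φ : Fin b → Fin b) (x : Fin b') : Fin b' :=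
  erasedIdx I e₀ (φ (e₀.symm x)) x

/-- Every value of the erased substitution is a variable or a constant. [folklore] -/
theorem erasedLabelSubst_X_or_C (r ℓ : BlockV b k m) :
    (∃ v, erasedLabelSubst I e₀ r ℓ = X v) ∨ ∃ c, erasedLabelSubst I e₀ r ℓ = C c := by
  rcases r with i | y
  · by_cases hi : i ∈ I
    · right
      exact ⟨1, by simp [erasedLabelSubst, hi]⟩
    · by_cases hj : phaseIdx i ℓ ∈ I
      · right
        exact ⟨0, by simp [erasedLabelSubst, hi, erasedTarget, hj]⟩
      · left
        exact ⟨(e₀ ⟨i, hi⟩, erasedIdx I e₀ (phaseIdx i ℓ) (e₀ ⟨i, hi⟩)),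
          by simp [erasedLabelSubst, hi, erasedTarget, hj]⟩
  · right
    exact ⟨1, by simp [erasedLabelSubst]⟩

/-- The erased substitution is a projection. [folklore] -/
theorem isProjection_erasedSubst (eR eC : BlockV b k m ≃ Fin n)
    (p : MvPolynomial (Fin n × Fin n) ℝ≥0) :
    IsProjection (aeval (erasedSubst I e₀ eR eC) p) p :=
  ⟨erasedSubst I e₀ eR eC, fun _ => erasedLabelSubst_X_or_C I e₀ _ _, rfl⟩

/-- The erased substitution does not see the rows at `I`: a cell whose row label is a hub row
`i ∈ I` or an internal vertex `(i, j, t)` goes to `1`. [folklore] -/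
theorem erasedLabelSubst_eq_one {r : BlockV b k m} (ℓ : BlockV b k m)
    (hr : ∃ i ∈ I, r = Sum.inl i ∨ ∃ (j : Fin b) (t : Fin k), r = Sum.inr (Sum.inl (i, j, t))) :
    erasedLabelSubst I e₀ r ℓ = 1 := by
  obtain ⟨i, hi, rfl | ⟨j, t, rfl⟩⟩ := hr
  · simp [erasedLabelSubst, hi]
  · rfl

/-- **Erasing first changes nothing.**  If every cell of `D` has its row label among the hub rows
`i ∈ I` and the internal vertices `(i, j, t)`, `i ∈ I`, then substituting `1` for the variables of
`D` and then applying the erased substitution is the erased substitution (two algebra maps that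
agree on the variables). [folklore] -/
theorem aeval_erasedSubst_aeval_erase (eR eC : BlockV b k m ≃ Fin n)
    (D : Finset (Fin n × Fin n))
    (hD : ∀ e ∈ D, ∃ i ∈ I, eR.symm e.1 = Sum.inl i ∨
      ∃ (j : Fin b) (t : Fin k), eR.symm e.1 = Sum.inr (Sum.inl (i, j, t)))
    (q : MvPolynomial (Fin n × Fin n) ℝ≥0) :
    aeval (erasedSubst I e₀ eR eC)
        (aeval (fun e : Fin n × Fin n =>
          if e ∈ D then (1 : MvPolynomial (Fin n × Fin n) ℝ≥0) else X e) q) =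
      aeval (erasedSubst I e₀ eR eC) q := by
  have h : (aeval (erasedSubst I e₀ eR eC)).comp
      (aeval (fun e : Fin n × Fin n =>
        if e ∈ D then (1 : MvPolynomial (Fin n × Fin n) ℝ≥0) else X e)) =
      aeval (erasedSubst I e₀ eR eC) := by
    refine MvPolynomial.algHom_ext fun e => ?_
    rw [AlgHom.comp_apply, aeval_X, aeval_X]
    split_ifs with he
    · rw [map_one]
      exact (erasedLabelSubst_eq_one I e₀ _ (hD e he)).symm
    · rw [aeval_X]
  exact DFunLike.congr_fun h q

/-! ### The image of a placed permutation monomial -/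

/-- The image of a placed permutation monomial is the product of the hub-row labels of its row
matching. [folklore] -/
theorem aeval_erasedSubst_monomial (eR eC : BlockV b k m ≃ Fin n) (σ : Equiv.Perm (Fin n)) :
    aeval (erasedSubst I e₀ eR eC) (monomial (permMonomial σ) (1 : ℝ≥0)) =
      ∏ i : Fin b, erasedLabelSubst I e₀ (Sum.inl i) (rowMatching eR eC σ (Sum.inl i)) := by
  -- adapted from `aeval_blockSubst_monomial`
  rw [show (monomial (permMonomial σ) (1 : ℝ≥0) : MvPolynomial _ ℝ≥0) = ∏ x, X (σ x, x) by
    rw [permMonomial, monomial_sum_one]; rfl]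
  rw [map_prod]
  simp only [aeval_X]
  rw [← Fintype.prod_equiv (eR.trans σ.symm)
    (fun r => erasedLabelSubst I e₀ r (rowMatching eR eC σ r))
    (fun x => erasedSubst I e₀ eR eC (σ x, x))
    (fun r => by simp [erasedSubst, rowMatching])]
  rw [Fintype.prod_sum_type]
  have h1 : ∏ y : (Fin b × Fin b × Fin k) ⊕ Fin m,
      erasedLabelSubst I e₀ (Sum.inr y) (rowMatching eR eC σ (Sum.inr y)) = 1 :=
    Finset.prod_eq_one fun _ _ => rfl
  rw [h1, mul_one]

/-- Only the hub rows outside `I` contribute: the product of the hub-row labels of a matching `g`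
is `∏_{i ∉ I} erasedTarget (e₀ i) (phaseMap g i)`. [folklore] -/
theorem prod_erasedLabelSubst (g : BlockV b k m ≃ BlockV b k m) :
    ∏ i : Fin b, erasedLabelSubst I e₀ (Sum.inl i) (g (Sum.inl i)) =
      ∏ a : {i // i ∉ I}, erasedTarget I e₀ (e₀ a) (phaseMap g a) := by
  rw [← Fintype.prod_subtype_mul_prod_subtype (fun i => i ∈ I)
    (fun i => erasedLabelSubst I e₀ (Sum.inl i) (g (Sum.inl i)))]
  rw [Finset.prod_eq_one (fun a _ => by simp [erasedLabelSubst, a.2]), one_mul]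
  refine Fintype.prod_congr _ _ fun a => ?_
  simp only [erasedLabelSubst, dif_neg a.2]
  rfl

/-- If the phase map sends some hub row outside `I` into `I`, the product vanishes (that factor is
the zeroed `0`). [folklore] -/
theorem prod_erasedTarget_of_not {φ : Fin b → Fin b} (hφ : ¬ ∀ i ∉ I, φ i ∉ I) :
    ∏ a : {i // i ∉ I}, erasedTarget I e₀ (e₀ a) (φ a) = 0 := by
  obtain ⟨i, hi, hφi⟩ : ∃ i ∉ I, φ i ∈ I := by simpa using hφ
  exact Finset.prod_eq_zero (Finset.mem_univ ⟨i, hi⟩) (by simp [erasedTarget, hφi])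

/-- If the phase map preserves the complement of `I`, the product is the pattern
`∏_x X (x, erasedPhase φ x)` of the induced self-map of `Fin b'`. [folklore] -/
theorem prod_erasedTarget_of_forall {φ : Fin b → Fin b} (hφ : ∀ i ∉ I, φ i ∉ I) :
    ∏ a : {i // i ∉ I}, erasedTarget I e₀ (e₀ a) (φ a) =
      ∏ x : Fin b', (X (x, erasedPhase I e₀ φ x) : MvPolynomial (Fin b' × Fin b') ℝ≥0) :=
  Fintype.prod_equiv e₀ _ _ fun a => by simp [erasedTarget, erasedPhase, hφ a a.2]

/-- The induced self-map of a bijection preserving the complement of `I` is a bijection of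
`Fin b'`. [folklore] -/
theorem erasedPhase_bijective {φ : Fin b → Fin b} (hφb : Function.Bijective φ)
    (hφ : ∀ i ∉ I, φ i ∉ I) : Function.Bijective (erasedPhase I e₀ φ) := by
  refine Function.Injective.bijective_of_finite fun x y h => ?_
  unfold erasedPhase erasedIdx at h
  rw [dif_neg (hφ _ (e₀.symm x).2), dif_neg (hφ _ (e₀.symm y).2)] at h
  have := hφb.1 (congrArg Subtype.val (e₀.injective h))
  exact e₀.symm.injective (Subtype.ext this)

/-! ### The image of the placed face permanent -/

/-- **The image of the erased/placed face permanent**: the sum, over the permutations `σ` inside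
the placed face whose phase map preserves the complement of `I`, of the patterns
`∏_x X (x, erasedPhase (phaseMap g_σ) x)` (the other permutations are killed by the zeroed
transversal). [folklore] -/
theorem aeval_erasedSubst_facePer (eR eC : BlockV b k m ≃ Fin n) :
    aeval (erasedSubst I e₀ eR eC) (facePer (placedBlock eR eC)) =
      ∑ σ ∈ ((Finset.univ : Finset (Equiv.Perm (Fin n))).filter
          (fun σ => ∀ i, (σ i, i) ∈ placedBlock eR eC)).filter
          (fun σ => ∀ i ∉ I, phaseMap (rowMatching eR eC σ) i ∉ I),
        ∏ x : Fin b', (X (x, erasedPhase I e₀ (phaseMap (rowMatching eR eC σ)) x) :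
          MvPolynomial (Fin b' × Fin b') ℝ≥0) := by
  rw [facePer, map_sum]
  conv_rhs => rw [Finset.sum_filter]
  refine Finset.sum_congr rfl fun σ _ => ?_
  rw [aeval_erasedSubst_monomial, prod_erasedLabelSubst]
  split_ifs with h
  · exact prod_erasedTarget_of_forall I e₀ h
  · exact prod_erasedTarget_of_not I e₀ h

/-- **Every permutation of `Fin b'` occurs**: extend `ρ` along `e₀` by the identity on `I`
(`Equiv.Perm.ofSubtype`), realise the extension as the phase map of a perfect matching `g` of
`G(b,k) ⊕ M₀` (`exists_adj_phaseMap_eq`), and place `g`. [folklore] -/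
theorem exists_erasedPhase_eq (eR eC : BlockV b k m ≃ Fin n) (ρ : Equiv.Perm (Fin b')) :
    ∃ σ ∈ ((Finset.univ : Finset (Equiv.Perm (Fin n))).filter
          (fun σ => ∀ i, (σ i, i) ∈ placedBlock eR eC)).filter
          (fun σ => ∀ i ∉ I, phaseMap (rowMatching eR eC σ) i ∉ I),
      erasedPhase I e₀ (phaseMap (rowMatching eR eC σ)) = ρ := by
  -- the extension of (the transport of) `ρ` by the identity on `I`
  set ρ' : Equiv.Perm {i // i ∉ I} := (e₀.trans ρ).trans e₀.symm with hρ'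
  obtain ⟨g, hg, hρ⟩ := exists_adj_phaseMap_eq b k m (Equiv.Perm.ofSubtype ρ')
  have hrow : rowMatching eR eC (eC.symm.trans (g.symm.trans eR)) = g := by
    ext r
    simp [rowMatching]
  refine ⟨eC.symm.trans (g.symm.trans eR), ?_, ?_⟩
  · simp only [Finset.mem_filter, Finset.mem_univ, true_and]
    refine ⟨fun x => ?_, fun i hi => ?_⟩
    · simp only [placedBlock, Finset.mem_filter, Finset.mem_univ, true_and, Equiv.trans_apply,
        Equiv.symm_apply_apply]
      have := hg (g.symm (eC.symm x))
      simpa using this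
    · rw [hrow, hρ, Equiv.Perm.ofSubtype_apply_of_mem ρ' hi]
      exact (ρ' ⟨i, hi⟩).2
  · funext x
    rw [hrow, hρ]
    simp only [erasedPhase, Equiv.Perm.ofSubtype_apply_coe]
    unfold erasedIdx
    rw [dif_neg (ρ' (e₀.symm x)).2]
    simp [hρ']

/-- **The image of the erased face permanent has the support of `per_{b'}`.** [folklore] -/
theorem support_aeval_erasedSubst_facePer (eR eC : BlockV b k m ≃ Fin n) :
    (aeval (erasedSubst I e₀ eR eC) (facePer (placedBlock eR eC))).support =
      (perPoly (Fin b') ℝ≥0).support := by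
  rw [aeval_erasedSubst_facePer]
  refine support_sum_prod_X_eq_perPoly _
    (fun σ => erasedPhase I e₀ (phaseMap (rowMatching eR eC σ))) ?_ ?_
  · intro σ hσ
    simp only [Finset.mem_filter, Finset.mem_univ, true_and] at hσ
    exact erasedPhase_bijective I e₀ (phaseMap_bijective_of_adj (adj_rowMatching hσ.1)) hσ.2
  · exact exists_erasedPhase_eq I e₀ eR eC

end Erased

/-! ### The stub -/

/-- **stub_erasedArsenal (the erased block face is still hard).**  For all `c κ` there are `d n₁`
(those of `complexity_gt_of_perSupport_projection`: `d = c + 3κ + 7`, `n₁ = 0`) such that for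
`n ≥ n₁`, every placement `eR eC` of `G(b,k) ⊕ M₀` with `k ≥ 1`, every set `I` of hub rows with
`b ≥ (log₂ n + d)^d + |I|`, and every set `D` of cells whose ROW label is a hub row `i ∈ I` or an
internal vertex `(i, j, t)` with `i ∈ I`:
`((n+2)(2^{(log₂ n + c)^c} + 3))^κ < L_{ℝ≥0}(Σ_{σ ⊆ G} x^{μ_σ ∖ D})` — the erased substitution
does not see `D` (`aeval_erasedSubst_aeval_erase`), is a projection, and its image has the support
of `per_{b - |I|}` (`support_aeval_erasedSubst_facePer`), so part Aux's
`complexity_gt_of_perSupport_projection` applies with `b' = b - |I| ≥ (log₂ n + d)^d`.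
[folklore] -/
theorem stub_erasedArsenal :
    ∀ c κ : ℕ, ∃ d n₁ : ℕ, ∀ n ≥ n₁, ∀ (b k m : ℕ) (eR eC : BlockV b k m ≃ Fin n)
      (I : Finset (Fin b)) (D : Finset (Fin n × Fin n)), 0 < k →
      (Nat.log 2 n + d) ^ d + I.card ≤ b →
      (∀ e ∈ D, ∃ i ∈ I, eR.symm e.1 = Sum.inl i ∨
        ∃ (j : Fin b) (t : Fin k), eR.symm e.1 = Sum.inr (Sum.inl (i, j, t))) →
      ((n + 2) * (2 ^ ((Nat.log 2 n + c) ^ c) + 3)) ^ κ <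
        complexity (aeval (fun e : Fin n × Fin n =>
          if e ∈ D then (1 : MvPolynomial (Fin n × Fin n) ℝ≥0) else X e)
            (facePer (placedBlock eR eC))) := by
  intro c κ
  obtain ⟨d, n₁, h⟩ := complexity_gt_of_perSupport_projection c κ
  refine ⟨d, n₁, fun n hn b k m eR eC I D _ hb hD => ?_⟩
  -- reindex the complement of `I` by `Fin (b - |I|)`
  have hcard : Fintype.card {i : Fin b // i ∉ I} = b - I.card := by
    simp [Fintype.card_subtype_compl, Fintype.card_coe]
  have e₀ : {i : Fin b // i ∉ I} ≃ Fin (b - I.card) := Fintype.equivFinOfCardEq hcard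
  refine h n hn (b - I.card) (Nat.le_sub_of_add_le hb) _
    ⟨aeval (erasedSubst I e₀ eR eC) (facePer (placedBlock eR eC)), ?_,
      support_aeval_erasedSubst_facePer I e₀ eR eC⟩
  rw [← aeval_erasedSubst_aeval_erase I e₀ eR eC D hD]
  exact isProjection_erasedSubst I e₀ eR eC _

end Summit.ValiantsHypothesis.ValiantsHypothesis.Theorems.DivisionGapPerDivisionHard

end
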